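import Summits.QuantumFields.YangMills.Theorems.BalabanUVNodesK0Stub1MultiplierLetterP
import Summits.QuantumFields.YangMills.Theorems.BalabanUVNodesK0FlatPortKernelRowsP
import HarnessLib

/-!
# K0⁷ STUB 1 (`stub_prop8StepCoP13`), sub-target S4 — **THE MULTIPLIER LETTER AT THE RECORD WITH NO DISPLAYED INPUT**: the `G_a` band sup row of
# `K0Stub1MultiplierLetterP.multiplierLetter_*` (the one input left displayed at the record) RE-EXPORTED FROM k0-s1-w3's d-generic port WITH ITS WEIGHTS EXPOSED —
# `K0FlatPortKernelRowsP.kernelRowsAt_domT` builds the genuine propagator `G_a = Δ_a⁻¹` at the print-natural band weights `a(c) = (Lᵏ∕L^{j(c)})²·(L^{j(c)})^{d}`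
# ([B6] (2.16): print's `a_j ≡ 1` in the `η`-weighted pairing) with its `GtSupLetterG`∕`GtLaplaceLetterG` rows ([B6] Prop. 2.6 (2.136) ported, `gRows_of_portShapes`) but exports
# them behind `∃ w′`; here the same assembly (its `G`-third only) returns the weights together with the band inequality `a(c) ≤ (Lᵏ)^{d−1}·L^{j(c)}` (`d` = dimension ≥ 3),
# hence ★★★ `exists_multiplierLetter_closed_of_adm22_T4`: print's `Q*(QGQ*)⁻¹QG`-row at EVERY admissible family of NODE 00's four-tori, every top window, every `M_N(ℂ)`-valued
# current — all four P2 inputs of the letter DISCHARGED by tree theorems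

Cell `pub-ymgap`, width seat `pub-ymgap-k0-s1-w4` g0 (INTENT-2).  `--kind proof --supports stmt-QuantumFields-20541 --as helper`; count-neutral.  [15] = [Balaban1985Variational];
[B6] = [Balaban1984PropagatorsII].

WHAT IS PROVED (sorry-free; no definition; axioms standard).
* §1 `band_of_unitWeights` — the port's weights `(cf∕Lʲ)²(Lʲ)^{d+1}` are `≤ cf^{d}·Lʲ` for `Lʲ ≤ cf`, `d ≥ 2` (real arithmetic) · ★ `gRowsBand_domT` — at every charted family
  `domT hN D hk` of the tori `PV d ℓ m K` (dimension `d + 1 ≥ 3`, odd `L = ℓ + 1 ≥ 5`): thresholds `Mh₀, R₀` and ONE constant `C_G ≥ 0` such that for all heights, big blocks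
  `M_h = Lᵃ ≥ Mh₀`, `R ≥ R₀`, periods `P′ = L·P″`, `P″ ≥ 5` and every (152) weight family `w`: THERE ARE weights `a > 0` and a plain-function `G` with `IsFlatGW … a G`,
  `GtSupLetterG … w G C_G`, `GtLaplaceLetterG … w G C_G` AND `a(c) ≤ (L^{K−n})^{d}·L^{j(c)}` — the `G`-third of `kernelRowsAt_domT` ([B6] Prop. 2.6 at the unit band ∘ Lemma 2.1
  at rate `δ₃∕2` ∘ the absorption threshold ∘ `gRows_of_portShapes`) with the weights in the open.
* §2 ★★ `gRowsBand_of_adm22` — the same at EVERY `Adm22 D R (L·M_h)` family of the P2 text (level-0 chart `FlatPortChartL0.tdOfAdmL0`, as `kernelRowsAt_of_adm22`).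
* §3 `gRowsBand_of_adm22_T4` — the `F : T4Family` instance (`PV 3 ℓ m K = F.P K` by `rfl`); ★★★ `exists_multiplierLetter_closed_of_adm22_T4` — P9 `body_of_adm22_T4` (the `H`-rows)
  + §3 (the `G_a` band row) + `qContrLetter_of_adm22` (the `Q`-row) into `K0Stub1MultiplierLetterP.multiplierLetter_matrix_of_bodyAt_adm22`: for every `F` there are `Mh₀, R₀` and
  constants `B₀`, `δ₀ > 0`, `B₃ > 0`, `C_G ≥ 0` such that at every admissible family of the record's tori, every top window `Y`, every matrix current with `w₃‖f‖ ≤ β` and every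
  bond `b₋ ∈ Y`: `‖ℳ(b)‖ ≤ (B₀B₃ + 1)·L·C_G·β` for the kernel extension `ℳ` of `𝔐 = Q*(QGQ*)⁻¹QG` (units `L^{K−n}`, `a ≡ 1`) — NO displayed input beyond admissibility.
HONEST SCOPE.  Bookkeeping over k0-s1-w3's port and lit-balaban's hypothesis-free k-level [B6] theorems (Prop. 2.6 (2.136), Lemma 2.1); the multiplier letter is print's (133)∕(137)
estimate AT THE FLAT BACKGROUND, TOP LAYER ONLY; nothing of Bałaban's analysis asserted beyond the cited kernel theorems; `stub_prop8StepCoP13` ∕ K0⁷ NOT closed; N07 NOT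
discharged; counts unmoved (28∕28 · 5∕27); one finite 𝕋⁴ programme at fixed ε — R4 closes the conditional finite-𝕋⁴ rung `BalabanLadder.UV` only, never the summit; the YM
mass gap (Clay) is NOT proved by any of this; nothing continuum ∕ ℝ⁴ ∕ OS.  No `sorry`, no `def`, no `instance`, no `notation`.

References: [15] (131)–(133) p.298, (165) p.304; [B6] (2.1)–(2.2) p.224, (2.16) p.225, Lemma 2.1 (2.59)–(2.61) pp.233–234, Prop. 2.6 (2.136) p.247, Cor. 2.8 (2.150)–(2.151)
p.249; [Balaban1987RG1] (0.1) p.251.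
-/

set_option autoImplicit false

noncomputable section

open scoped BigOperators InnerProductSpace Matrix.Norms.L2Operator

namespace Summit.QuantumFields.YangMills.Theorems.K0Stub1MultiplierLetterAtRecord

open K0FlatPortBudgetsP (theta_budget absorb_budget chart_params)
open K0FlatPortKernelRowsP (unitWeights_pos globalBand_unitWeights)
open K0FlatPortGRowsP (gRows_of_portShapes)

open Literature.MathematicalPhysics.QuantumFieldTheory.Balaban1983to89
open Literature.MathematicalPhysics.QuantumFieldTheory.Balaban1983to89.T4Continuum (T4Family)
open B6MultiLevelBoxOperator (N0)
open B6MultiLevelTorusOperatorL0 (TDomains)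
open B6Geom246MultiLevelTorusL0 (geomT lemma21_torus)
open B6GlobalChartV1 (PV)
open B6GlobalChartV1L0 (domT)
open B6Ineq2133TwoScaleV1 (onFun)
open B6RandomWalk (delta3 delta3_pos)
open B6Ineq261LevelGap (K261 K261_nonneg)
open B6SectADomainsV1 (Domains)
open B6SectAOperatorsV1 (BondIdx QE QsE)
open B6SectAVectorModelV1 (GE EE)
open FlatPortHRows12 (cf_ne_zero)
open B6Prop26LapKLevelV1L0 (prop26_2136_lap_kLevel_unconditional_pad_V1)
open Summit.QuantumFields.YangMills.Theorems.FlatCubeOpsText (Adm22)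
open Summit.QuantumFields.YangMills.Theorems.K0FlatCubeOpsTextP (IsLevWeight IsFlatGW GtSupLetterG GtLaplaceLetterG)
open Summit.QuantumFields.YangMills.Theorems.K0FlatPortBodyP (body_of_adm22_T4)
open Summit.QuantumFields.YangMills.Theorems.K0Stub1MultiplierLetterP (multiplierLetter_matrix_of_bodyAt_adm22)

variable {N : ℕ}

/-! ## §1  The `G`-rows of the port WITH THEIR BAND WEIGHTS EXPOSED, at every charted family -/

/-- the port's print-natural weights `(cf∕Lʲ)²·(Lʲ)^{d+1}` lie under the band `cf^{d}·Lʲ` whenever `1 ≤ L`, `Lʲ ≤ cf` and the dimension `d + 1` is at least `3`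
(real arithmetic: `(cf∕Lʲ)²(Lʲ)^{d+1} = cf²·(Lʲ)^{d−2}·Lʲ ≤ cf²·cf^{d−2}·Lʲ`). [cite: Balaban1984PropagatorsII, (2.16) p.225 (bookkeeping)] -/
theorem band_of_unitWeights {Lr cf : ℝ} {d j : ℕ} (hd : 2 ≤ d) (hL : 1 ≤ Lr) (hj : Lr ^ j ≤ cf) :
    (cf / Lr ^ j) ^ 2 * (Lr ^ j) ^ (d + 1) ≤ cf ^ d * Lr ^ j := by
  have hLj : 0 < Lr ^ j := pow_pos (lt_of_lt_of_le zero_lt_one hL) j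
  have hcf : 0 ≤ cf := hLj.le.trans hj
  have e1 : (cf / Lr ^ j) ^ 2 * (Lr ^ j) ^ (d + 1) = cf ^ 2 * (Lr ^ j) ^ (d - 2) * Lr ^ j := by
    have hd' : d + 1 = 2 + (d - 2) + 1 := by omega
    rw [hd', pow_add, pow_add, pow_one, div_pow]
    field_simp
  have e2 : cf ^ d = cf ^ 2 * cf ^ (d - 2) := by rw [← pow_add]; congr 1; omega
  rw [e1, e2]
  have h1 : (Lr ^ j) ^ (d - 2) ≤ cf ^ (d - 2) := pow_le_pow_left₀ hLj.le hj _
  have h2 : 0 ≤ cf ^ 2 := pow_nonneg hcf 2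
  have h3 : cf ^ 2 * (Lr ^ j) ^ (d - 2) ≤ cf ^ 2 * cf ^ (d - 2) := mul_le_mul_of_nonneg_left h1 h2
  exact mul_le_mul_of_nonneg_right h3 hLj.le

/-- ★ **THE `G`-ROWS OF THE P2 PORT AT A CHARTED FAMILY, BAND WEIGHTS IN THE OPEN** (the `G`-third of k0-s1-w3's `K0FlatPortKernelRowsP.kernelRowsAt_domT`, same thresholds and
constant): for odd `L = ℓ + 1 ≥ 5` and dimension `d + 1 ≥ 3` there are `Mh₀, R₀` and `C_G ≥ 0` (functions of `d, L`) such that for every height `K − n ≥ 1`, every torus family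
with `M_h = Lᵃ ≥ Mh₀`, `R ≥ R₀`, `P′ = L·P″`, `P″ ≥ 5`, and every P2 weight family `w`, the genuine propagator `G_a = Δ_a⁻¹` at the weights `a(c) = (L^{K−n}∕L^{j(c)})²(L^{j(c)})^{d+1}`
is pinned (`IsFlatGW`), carries the `GtSupLetterG`∕`GtLaplaceLetterG` rows with constant `C_G`, and `a(c) ≤ (L^{K−n})^{d}·L^{j(c)}` — lit-balaban's hypothesis-free [B6] Prop. 2.6
(2.136) at the unit band (`prop26_2136_lap_kLevel_unconditional_pad_V1`) ∘ Lemma 2.1 on the torus at rate `δ₃∕2` ∘ the absorption threshold ∘ `K0FlatPortGRowsP.gRows_of_portShapes`.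
[cite: Balaban1984PropagatorsII, Prop. 2.6 (2.136) p.247, (2.16) p.225, Lemma 2.1 (2.59)-(2.61) pp.233-234; Balaban1985Variational, (165) p.304] -/
theorem gRowsBand_domT (d ℓ : ℕ) (hd : 1 ≤ d + 1) (hL : Odd (ℓ + 1) ∧ 1 < ℓ + 1) (hℓ : 4 ≤ ℓ) (hd2 : 2 ≤ d) :
    ∃ (Mh₀ R₀ : ℕ) (CG : ℝ), 0 ≤ CG ∧
    ∀ (m : ℕ) (n K : ℕ) {Mh R : ℕ} {P' : Fin (d + 1) → ℕ} (hN : ∀ μ, N0 ℓ Mh (K - n) P' μ = (PV d ℓ m K hd hL).sitesPerDir 0)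
      (D : TDomains d ℓ Mh (K - n) P' R) (hk : K - n ≤ m + K) (_ : 1 ≤ K - n)
      {P'' : Fin (d + 1) → ℕ} (_ : ∀ μ, P' μ = (ℓ + 1) * P'' μ) (_ : ∀ μ, 5 ≤ P'' μ)
      {a : ℕ} (_ : Mh = (ℓ + 1) ^ a) (_ : Mh₀ ≤ Mh) (_ : R₀ ≤ R)
      (w : ℕ → PBond (PV d ℓ m K hd hL) 0 → ℝ) (_ : IsLevWeight (PV d ℓ m K hd hL) (K - n) (B6GlobalChartV1L0.domT hN D hk) w),
      ∃ (aw : BondIdx (domT hN D hk) → ℝ) (haw : ∀ i, 0 < aw i) (G : (PBond (PV d ℓ m K hd hL) 0 → ℝ) →ₗ[ℝ] (PBond (PV d ℓ m K hd hL) 0 → ℝ)),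
        IsFlatGW (PV d ℓ m K hd hL) (K - n) (domT hN D hk) haw G ∧
        GtSupLetterG (PV d ℓ m K hd hL) (K - n) w G CG ∧ GtLaplaceLetterG (PV d ℓ m K hd hL) (K - n) w G CG ∧
        ∀ c : BondIdx (domT hN D hk), aw c ≤ ((((ℓ + 1 : ℕ) : ℝ)) ^ (K - n)) ^ d * (((ℓ + 1 : ℕ) : ℝ)) ^ (c.1.1 : ℕ) := by
  -- [B6] Prop. 2.6 (2.136) at the unit band `b₀ = b₁ = 1`
  obtain ⟨σ, hσ0, hC⟩ := prop26_2136_lap_kLevel_unconditional_pad_V1 d ℓ hd hL one_pos (le_refl (1 : ℝ))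
  obtain ⟨A, M₂c, hA0, hM₂c, hrowsC⟩ := hC σ hσ0 le_rfl (1 / 2) (by norm_num) (by norm_num)
  -- the rate and the Lemma-2.1 ∕ absorption budgets at `δ₃∕2`
  set δ₃ : ℝ := delta3 (1 / 2) (2 * σ) with hδ₃
  have hδ₃0 : 0 < δ₃ := delta3_pos (by norm_num) (by linarith)
  obtain ⟨hNgpos, hθg⟩ := theta_budget d ℓ (show 0 < 1 / 2 * δ₃ by positivity)
  set Ng : ℕ := ⌈2 * ((d + 1 : ℕ) : ℝ) * Real.log ((ℓ : ℝ) + 1) / (1 / 2 * δ₃)⌉₊ + 1 with hNg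
  set Nag : ℕ := ⌈2 * ((d : ℝ) + 3) * ((ℓ : ℝ) + 1) / δ₃⌉₊ with hNag
  set Lr : ℝ := (ℓ : ℝ) + 1 with hLr
  have hL1 : (1 : ℝ) ≤ Lr := by rw [hLr]; linarith [(Nat.cast_nonneg ℓ : (0 : ℝ) ≤ ℓ)]
  set c1g : ℝ := K261 Ng (d + 1) Lr 1 (1 / 2 * δ₃) with hc1g
  have hc1g0 : 0 ≤ c1g := K261_nonneg (by linarith : (0 : ℝ) ≤ Lr) zero_le_one
  -- thresholds
  set Mh₀ : ℕ := max 8 ⌈M₂c⌉₊ with hMh₀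
  set R₀ : ℕ := max (2 * (ℓ + 1) ^ 2) (max (Ng + 1) (Nag + 1)) with hR₀
  refine ⟨Mh₀, R₀, A * Lr ^ 3 * c1g, by positivity, ?_⟩
  intro m n K Mh R P' hN D hk hk1 P'' hLP hP5 a hMha hMh hR w hw
  -- unpack the thresholds
  have hM8 : 8 ≤ Mh := le_trans (le_max_left _ _) hMh
  have hMh1 : 1 ≤ Mh := le_trans (by norm_num) hM8
  have hR2 : 2 * (ℓ + 1) ^ 2 ≤ R := le_trans (le_max_left _ _) hR
  have hRLM : ∀ {N₁ : ℕ}, N₁ + 1 ≤ R₀ → N₁ + 1 ≤ R * ((ℓ + 1) * Mh) := fun {N₁} h =>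
    le_trans (le_trans h hR) (Nat.le_mul_of_pos_right R (Nat.mul_pos (Nat.succ_pos ℓ) (by omega)))
  have hNg' : Ng + 1 ≤ R * ((ℓ + 1) * Mh) := hRLM (le_trans (le_trans (le_max_left _ _) (le_max_right _ _)) le_rfl)
  have hNag' : Nag + 1 ≤ R * ((ℓ + 1) * Mh) := hRLM (le_trans (le_trans (le_max_right _ _) (le_max_right _ _)) le_rfl)
  have hRM1 : 1 ≤ R * ((ℓ + 1) * Mh) := le_trans (by omega) hNg'
  have hM₂c' : M₂c ≤ ((ℓ : ℝ) + 1) * Mh := by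
    have h1 : M₂c ≤ (⌈M₂c⌉₊ : ℝ) := Nat.le_ceil _
    have h2 : (⌈M₂c⌉₊ : ℝ) ≤ (Mh : ℝ) := by exact_mod_cast le_trans (le_max_right _ _) hMh
    have h3 : (Mh : ℝ) ≤ ((ℓ : ℝ) + 1) * Mh := le_mul_of_one_le_left (Nat.cast_nonneg _) hL1
    linarith
  have hP1 : ∀ μ, 1 ≤ P' μ := fun μ => by rw [hLP μ]; exact Nat.mul_pos (Nat.succ_pos ℓ) (by have := hP5 μ; omega)
  have hP5L : ∀ μ, 5 * (ℓ + 1) ≤ P' μ := fun μ => by rw [hLP μ, mul_comm]; exact Nat.mul_le_mul_left _ (hP5 μ)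
  -- the band weights
  set ws : BondIdx (domT hN D hk) → ℝ := fun i =>
    ((((ℓ + 1 : ℕ) : ℝ)) ^ (K - n) / (((ℓ + 1 : ℕ) : ℝ)) ^ (i.1.1 : ℕ)) ^ 2 * ((((ℓ + 1 : ℕ) : ℝ)) ^ (i.1.1 : ℕ)) ^ (d + 1) with hws_def
  have hws : ∀ i, 0 < ws i := unitWeights_pos d ℓ hd hL m n K hN D hk
  have hband := globalBand_unitWeights d ℓ hd hL m n K hN D hk
  -- [B6] Prop. 2.6 at these data; Lemma 2.1 (2.61) at rate `δ₃∕2`; absorption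
  obtain ⟨hGm, hDGm, hLapm⟩ := hrowsC m K hN D hk hk1 hMha hM8 hR2 hP5L hℓ hM₂c' (cf_ne_zero ℓ n K) hws hband
  obtain ⟨-, h261g, -, -⟩ := lemma21_torus (D := D) hMh1 hP1 hNgpos hNg' hδ₃0.le (by norm_num : (0 : ℝ) ≤ 1 / 2)
    (by norm_num : (1 : ℝ) / 2 ≤ 1) hθg
  obtain ⟨-, hsmg, -⟩ := absorb_budget d ℓ hδ₃0 hNag'
  obtain ⟨hflat, hsup, hlap⟩ := gRows_of_portShapes d ℓ hd hL m n K hN D hk hMh1 hP1 hRM1 hws hA0 hδ₃0.le hGm hDGm hLapm hsmg h261g w hw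
  refine ⟨ws, hws, _, hflat, hsup, hlap, fun c => ?_⟩
  -- the band: `(cf∕Lʲ)²(Lʲ)^{d+1} ≤ cf^{d}·Lʲ` since `j ≤ K − n`
  have hLr1 : (1 : ℝ) ≤ ((ℓ + 1 : ℕ) : ℝ) := by exact_mod_cast Nat.succ_le_succ (Nat.zero_le ℓ)
  have hj : (c.1.1 : ℕ) ≤ K - n := by
    have h1 := Nat.lt_succ_iff.1 c.1.1.isLt
    exact h1.trans (le_of_eq rfl)
  exact band_of_unitWeights hd2 hLr1 (pow_le_pow_right₀ hLr1 hj)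

/-! ## §2  Every `Adm22` family of the P2 text (level-0 chart) -/

/-- ★★ **THE `G`-ROWS WITH BAND WEIGHTS AT EVERY ADMISSIBLE FAMILY — NO `Ω₁ = T` HYPOTHESIS** (via k0-s1-w3's level-0 chart `FlatPortChartL0.tdOfAdmL0`∕`domT_tdOfAdmL0`, as
`kernelRowsAt_of_adm22`): for odd `L = ℓ + 1 ≥ 5`, dimension `d + 1 ≥ 3`, there are `Mh₀, R₀` and `C_G ≥ 0` such that for all heights `1 ≤ K − n`, big blocks `M = L·M_h`,
`M_h = L^{a′} ≥ Mh₀`, `R ≥ R₀`, torus size `a′ + 3 ≤ m + n`, every `D : Domains (PV d ℓ m K)` with `D.k = K − n`, `Adm22 D R (L·M_h)`, and every P2 weight family: a positive weight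
family `a` with `a(c) ≤ (L^{K−n})^{d}·L^{j(c)}` and the pinned genuine propagator `G_a` with both letters at constant `C_G`.
[cite: Balaban1984PropagatorsII, (2.1)-(2.2) p.224, (2.16) p.225, Prop. 2.6 (2.136) p.247; Balaban1985Variational, (165) p.304] -/
theorem gRowsBand_of_adm22 (d ℓ : ℕ) (hd : 1 ≤ d + 1) (hL : Odd (ℓ + 1) ∧ 1 < ℓ + 1) (hℓ : 4 ≤ ℓ) (hd2 : 2 ≤ d) :
    ∃ (Mh₀ R₀ : ℕ) (CG : ℝ), 0 ≤ CG ∧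
    ∀ (m : ℕ) (n K : ℕ) (_ : 1 ≤ K - n) {Mh R a' : ℕ} (_ : Mh = (ℓ + 1) ^ a') (_ : Mh₀ ≤ Mh) (_ : R₀ ≤ R) (_ : a' + 3 ≤ m + n)
      (D : Domains (PV d ℓ m K hd hL)) (hDk : D.k = K - n) (_ : Adm22 D R ((ℓ + 1) * Mh))
      (w : ℕ → PBond (PV d ℓ m K hd hL) 0 → ℝ) (_ : IsLevWeight (PV d ℓ m K hd hL) (K - n) D w),
      ∃ (aw : BondIdx D → ℝ) (haw : ∀ i, 0 < aw i) (G : (PBond (PV d ℓ m K hd hL) 0 → ℝ) →ₗ[ℝ] (PBond (PV d ℓ m K hd hL) 0 → ℝ)),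
        IsFlatGW (PV d ℓ m K hd hL) (K - n) D haw G ∧
        GtSupLetterG (PV d ℓ m K hd hL) (K - n) w G CG ∧ GtLaplaceLetterG (PV d ℓ m K hd hL) (K - n) w G CG ∧
        ∀ c : BondIdx D, aw c ≤ ((((ℓ + 1 : ℕ) : ℝ)) ^ (K - n)) ^ d * (((ℓ + 1 : ℕ) : ℝ)) ^ (c.1.1 : ℕ) := by
  obtain ⟨Mh₀, R₀, CG, hCG, hmain⟩ := gRowsBand_domT d ℓ hd hL hℓ hd2
  refine ⟨Mh₀, R₀, CG, hCG, ?_⟩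
  intro m n K hk1 Mh R a' hMha hMh hR hsize D hDk hAdm w hw
  have hk : K - n ≤ m + K := by omega
  obtain ⟨hN, hLP, hP5⟩ := chart_params d ℓ m n K a' hd hL hℓ hk1 hsize
  rw [hMha] at hAdm
  have hN' : ∀ μ : Fin (d + 1), N0 ℓ Mh (K - n) (fun _ => 2 * (ℓ + 1) ^ (m + n - 1 - a')) μ = (PV d ℓ m K hd hL).sitesPerDir 0 := by
    rw [hMha]; exact hN
  rw [← hMha] at hAdm
  set D' := FlatPortChartL0.tdOfAdmL0 hN' D hDk hk hAdm with hD'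
  have hEq : domT hN' D' hk = D := FlatPortChartL0.domT_tdOfAdmL0 hN' D hDk hk hAdm
  rw [← hEq] at hw ⊢
  exact hmain m n K hN' D' hk hk1 hLP hP5 hMha hMh hR w hw

/-! ## §3  NODE 00's four-tori: the `G_a` band row, and the multiplier letter with every input discharged -/

/-- **THE `G_a` BAND ROW ON THE RECORD's TORI** (`T4Family.P K = PV 3 ℓ m K` by `rfl`): thresholds `Mh₀, R₀` and `C_G ≥ 0` such that every admissible family of `Site (F.P K) 0`
in the standing range carries a positive weight family `a ≤ (L^{K−n})³·L^{j(·)}` and the pinned `G_a` with its two letters at `C_G`.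
[cite: Balaban1984PropagatorsII, Prop. 2.6 (2.136) p.247, (2.16) p.225; Balaban1987RG1, (0.1) p.251] -/
theorem gRowsBand_of_adm22_T4 (F : T4Family) :
    ∃ (Mh₀ R₀ : ℕ) (CG : ℝ), 0 ≤ CG ∧
    ∀ (n K : ℕ) (_ : 1 ≤ K - n) {Mh R a' : ℕ} (_ : Mh = F.L ^ a') (_ : Mh₀ ≤ Mh) (_ : R₀ ≤ R) (_ : a' + 3 ≤ F.m + n)
      (D : Domains (F.P K)) (hDk : D.k = K - n) (_ : Adm22 D R (F.L * Mh))
      (w : ℕ → PBond (F.P K) 0 → ℝ) (_ : IsLevWeight (F.P K) (K - n) D w),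
      ∃ (aw : BondIdx D → ℝ) (haw : ∀ i, 0 < aw i) (G : (PBond (F.P K) 0 → ℝ) →ₗ[ℝ] (PBond (F.P K) 0 → ℝ)),
        IsFlatGW (F.P K) (K - n) D haw G ∧ GtSupLetterG (F.P K) (K - n) w G CG ∧ GtLaplaceLetterG (F.P K) (K - n) w G CG ∧
        ∀ c : BondIdx D, aw c ≤ ((F.L : ℝ) ^ (K - n)) ^ (4 - 1) * (F.L : ℝ) ^ (c.1.1 : ℕ) := by
  obtain ⟨L, hL, h11, m, hm⟩ := F
  obtain ⟨ℓ, rfl⟩ : ∃ ℓ, L = ℓ + 1 := ⟨L - 1, by omega⟩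
  have hℓ : 4 ≤ ℓ := by omega
  obtain ⟨Mh₀, R₀, CG, hCG, hmain⟩ := gRowsBand_of_adm22 3 ℓ K0FlatCubeOpsTextP.hd4 hL hℓ (by norm_num)
  refine ⟨Mh₀, R₀, CG, hCG, ?_⟩
  intro n K hk1 Mh R a' hMha hMh hR hsize D hDk hAdm w hw
  exact hmain m n K hk1 hMha hMh hR hsize D hDk hAdm w hw

/-- ★★★ **THE MULTIPLIER LETTER AT EVERY ADMISSIBLE FAMILY OF THE RECORD's TORI, EVERY INPUT DISCHARGED**: for every `F : T4Family` there are thresholds `Mh₀, R₀` and constants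
`B₀`, `δ₀ > 0`, `B₃ > 0`, `C_G ≥ 0` such that for all heights in the standing range (`1 ≤ K − n`, `K − n + 1 ≤ m + K`), every nested family `D` of top level `K − n` on `Site (F.P K) 0`
with `Adm22 D R (L·M_h)` (`M_h = L^{a′} ≥ Mh₀`, `R ≥ R₀`, `a′ + 3 ≤ m + n`) and the (152) level weights `w`: for every top window `Y ⊆ Ω_{K−n}`, every `M_N(ℂ)`-valued current with
`w₃‖f‖ ≤ β` and every bond `b₋ ∈ Y`, the kernel extension `ℳ(b) = Σ_{b′}(𝔐e_{b′})(b)·f(b′)` of print's `𝔐 = Q*(QGQ*)⁻¹QG` (units `L^{K−n}`, `a ≡ 1`) obeys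
`‖ℳ(b)‖ ≤ (B₀B₃ + 1)·L·C_G·β` — the `H`-rows from P9 `body_of_adm22_T4`, the `G_a` band row from §3, the `Q`-row from `qContrLetter_of_adm22`; this is the `β₂` ∕ `hM` input of the
third (165) row for `A₁` at the record with nothing displayed. [cite: Balaban1985Variational, (131)-(133) p.298, (152) p.301, (165) p.304; Balaban1984PropagatorsII, (2.1)-(2.2) p.224, Prop. 2.6 (2.136) p.247, Cor. 2.8 (2.150)-(2.151) p.249] -/
theorem exists_multiplierLetter_closed_of_adm22_T4 (F : T4Family) :
    ∃ (Mh₀ R₀ : ℕ) (B₀ δ₀ B₃ CG : ℝ), 0 < δ₀ ∧ 0 < B₃ ∧ 0 ≤ CG ∧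
    ∀ (n K : ℕ) (_ : 1 ≤ K - n) (_ : K - n + 1 ≤ F.m + K) {Mh R a' : ℕ} (_ : Mh = F.L ^ a') (_ : Mh₀ ≤ Mh) (_ : R₀ ≤ R)
      (_ : a' + 3 ≤ F.m + n) (D : Domains (F.P K)) (hDk : D.k = K - n) (_ : Adm22 D R (F.L * Mh))
      (w : ℕ → PBond (F.P K) 0 → ℝ) (_ : IsLevWeight (F.P K) (K - n) D w)
      {instDE : DecidableEq (PBond (F.P K) 0)}
      (Mop : (PBond (F.P K) 0 → ℝ) →ₗ[ℝ] (PBond (F.P K) 0 → ℝ))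
      (_ : ∀ (f : PBond (F.P K) 0 → ℝ) (b : PBond (F.P K) 0),
        Mop f b = QsE D (EE D (c := ((F.P K).L : ℝ) ^ (K - n)) (pow_ne_zero _ (Nat.cast_ne_zero.2 (F.P K).L_pos.ne')) (w := fun _ => (1 : ℝ)) (fun _ => one_pos)
          (QE D (GE D (c := ((F.P K).L : ℝ) ^ (K - n)) (pow_ne_zero _ (Nat.cast_ne_zero.2 (F.P K).L_pos.ne')) (w := fun _ => (1 : ℝ)) (fun _ => one_pos)
            (WithLp.toLp 2 f)))) b)
      {Y : Set (Site (F.P K) 0)} (_ : ∀ x ∈ Y, D.InOm (K - n) x)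
      {f ℳ : PBond (F.P K) 0 → Matrix (Fin N) (Fin N) ℂ} {β : ℝ} (_ : 0 ≤ β) (_ : ∀ b, w 3 b * ‖f b‖ ≤ β)
      (_ : ∀ b, ℳ b = ∑ b', Mop (Pi.single b' 1) b • f b') (b : PBond (F.P K) 0) (_ : b.src ∈ Y),
      ‖ℳ b‖ ≤ (B₀ * B₃ + 1) * (F.L : ℝ) * CG * β := by
  obtain ⟨Mh₀, R₀, B₀, δ₀, B₃, hδ₀, hB₃, hbody⟩ := body_of_adm22_T4 F
  obtain ⟨Mh₀', R₀', CG, hCG, hG⟩ := gRowsBand_of_adm22_T4 F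
  refine ⟨max Mh₀ Mh₀', max (max R₀ R₀') 2, B₀, δ₀, B₃, CG, hδ₀, hB₃, hCG, ?_⟩
  intro n K hk1 hk' Mh R a' hMha hMh hR hsize D hDk hAdm w hw instDE Mop hMop Y hY f ℳ β hβ hf hℳ b hb
  have hMh₁ : Mh₀ ≤ Mh := le_trans (le_max_left _ _) hMh
  have hMh₂ : Mh₀' ≤ Mh := le_trans (le_max_right _ _) hMh
  have hR₁ : R₀ ≤ R := le_trans (le_trans (le_max_left _ _) (le_max_left _ _)) hR
  have hR₂ : R₀' ≤ R := le_trans (le_trans (le_max_right _ _) (le_max_left _ _)) hR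
  have hR2 : 2 ≤ R := le_trans (le_max_right _ _) hR
  -- `2L ≤ R·(L·M_h)` from `R ≥ 2`, `M_h = L^{a′} ≥ 1`
  have hMh1 : 1 ≤ Mh := by rw [hMha]; exact Nat.one_le_pow _ _ (F.P K).L_pos
  have hRM : 2 * F.L ≤ R * (F.L * Mh) :=
    calc 2 * F.L ≤ R * F.L := Nat.mul_le_mul_right _ hR2
      _ = R * (F.L * 1) := by rw [mul_one]
      _ ≤ R * (F.L * Mh) := Nat.mul_le_mul_left _ (Nat.mul_le_mul_left _ hMh1)
  obtain ⟨aw, haw, G, hGW, hGsup, -, hband⟩ := hG n K hk1 hMha hMh₂ hR₂ hsize D hDk hAdm w hw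
  exact multiplierLetter_matrix_of_bodyAt_adm22 (P := F.P K) hDk hw (hbody n K hk1 hk' hMha hMh₁ hR₁ hsize D hDk hAdm w hw) hδ₀.le hB₃.le hAdm hRM haw hGW hCG
    hGsup hband Mop hMop hY hβ hf hℳ b hb

end Summit.QuantumFields.YangMills.Theorems.K0Stub1MultiplierLetterAtRecord

end
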